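import Literature.NumberTheory.NumberFields.RayClassFieldTwoVariableLiftableAvoiding
import Literature.NumberTheory.NumberFields.RayClassFieldLocalTowerDisjoint
import Literature.NumberTheory.GaloisRepresentations.LubinTateCharacterLimit
import HarnessLib

/-!
# Liftable auxiliary ideals with PRESCRIBED local behaviour at finite level: `(𝔞, K(𝔤v'^{N+1}v^{N+1})/K) = res τ̃`
# forces `χ_π(σ̃_𝔞) ≡ χ_π(τ̃) (mod π^{N+1})` and `σ̃_𝔞 ≡ τ̃` on the unramified base `E_{N+c}` — de Shalit's auxiliary
# ideals `𝔞₁, 𝔞₂` of II §4.12 chosen by Chebotarev in the two-variable tower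

De Shalit, *Iwasawa theory of elliptic curves with complex multiplication* (1987), II §4.12 (29)–(33): the division step of the
construction of the two-variable measure uses auxiliary integral ideals `𝔞₁, 𝔞₂` (prime to `6𝔣p`) whose Artin symbols have
prescribed behaviour on the `𝔭`-division tower (`σ_{𝔞₁}` «generic» in the Lubin–Tate direction) and on the unramified direction,
so that `σ_{𝔞₁} − N𝔞₁`, `σ_{𝔞₂} − N𝔞₂` are relatively prime in `Λ`; such ideals exist by Chebotarev (II §4.12 p. 67, «choose 𝔞
with `σ_𝔞` …», II §2.1 index convention `(𝔞, 6𝔣) = 1`).  In the tree the product rule of the elliptic units is indexed by the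
`IsLocArtinLiftable` ideals of `RayClassFieldTwoVariableDecomposition` with arbitrary local lifts `σ̃_𝔞 ∈ Γ_{K_v}`; THIS file
(sequel of `RayClassFieldTwoVariableLiftableAvoiding`, same towerData hypotheses) supplies the two facts that turn a
finite-level COINCIDENCE of Artin symbols into the local data the Coleman lane reads:

* §1 ★ `pow_dvd_lubinTateChar_sub_one_of_mem_fixingSubgroup_ltField` (bookkeeping: `τ` fixing `K_π^{n+1}` has `χ_π(τ) ≡ 1 (π^{n+1})`);
  ★★ `mem_fixingSubgroup_and_pow_dvd_lubinTateChar_sub_of_absRestrictNormalHom_eq` — if `σ̃, τ̃ ∈ Γ_{K_v}` have the SAME restriction to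
  `K(𝔤v'^{N+1}v^{N+1})`, then `τ̃⁻¹σ̃` fixes `E_{N+c}` (INERT) and **`π^{N+1} ∣ χ_π(σ̃) − χ_π(τ̃)`** (the local tower is generated by the
  global one over `E_{N+c}`: `mem_fixingSubgroup_ltField_of_forall_smul_absClosureEmbedding_eq`);
* §2 ★★★ `exists_isLocArtinLiftable_coprime_forall_lubinTateChar_congr` — for every `τ̃ ∈ Γ_{K_v}`, `N`, `𝔟 ≠ 0` there is a liftable
  `𝔞` prime to `𝔟` such that EVERY local lift `σ̃` of `(𝔞, K(𝔤v'^{N+1}v^{N+1})/K)` has `τ̃⁻¹σ̃ ∈ Gal(K̄_v/E_{N+c})` and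
  `χ_π(σ̃) ≡ χ_π(τ̃) (mod π^{N+1})` (`exists_isLocArtinLiftable_coprime_artinSymbol_eq` + §1).
With `τ̃` of Lubin–Tate character `γ` fixing `E_∞`, resp. `τ̃ = σ₀` the Frobenius, these are de Shalit's `𝔞₁`, `𝔞₂`.
Theorems only; no `sorry`; no definitions.

## References
* [deShalit1987] E. de Shalit, *Iwasawa theory of elliptic curves with complex multiplication* (1987), II §2.1 (p. 49), II §4.12
  (29)–(33) (p. 66–68), II §4.14 (p. 71).
* [NeukirchANT1999] J. Neukirch, *Algebraic Number Theory* (1999), Ch. VI §7 Thm. (7.1), Ch. VII §13 (13.4) (Chebotarev).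
* [CasselsFrohlichANT1967] Cassels–Fröhlich (1967), Ch. VI §3.6 Prop. 6.
-/

noncomputable section

open NumberField IsDedekindDomain IsDedekindDomain.HeightOneSpectrum Field
open scoped nonZeroDivisors Classical

namespace Literature.NumberTheory.NumberFields

open Literature.NumberTheory.GaloisRepresentations
open Literature.NumberTheory.GaloisRepresentations.IsNonarchimedeanLocalField
open Literature.NumberTheory.LFunctions.AbelianDensity (artinSymbol)
open ValuativeRel

variable {K : Type} [Field K] [NumberField K] {𝔤 : Ideal (𝓞 K)} {v v' : HeightOneSpectrum (𝓞 K)}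

/-! ### §0. Restrictions (bookkeeping, as in the prequels) -/

omit [NumberField K] in
/-- `((τ|_L) x : K̄) = τ • x`. [folklore] -/
private theorem coe_absRestrictNormalHom_apply₂₀ (L : IntermediateField K (AlgebraicClosure K)) [Normal K L]
    (τ : absoluteGaloisGroup K) (x : L) :
    ((absRestrictNormalHom L τ x : L) : AlgebraicClosure K) = τ • (x : AlgebraicClosure K) :=
  AlgEquiv.restrictNormalHom_apply L _ x

omit [NumberField K] in
/-- `res_L ρ = res_L ρ'` iff `ρ`, `ρ'` agree on `L` pointwise. [folklore] -/
private theorem absRestrictNormalHom_eq_iff_forall_smul_eq₂₀ (L : IntermediateField K (AlgebraicClosure K)) [Normal K L]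
    (ρ ρ' : absoluteGaloisGroup K) :
    absRestrictNormalHom L ρ = absRestrictNormalHom L ρ' ↔ ∀ x ∈ L, ρ • x = ρ' • x := by
  constructor
  · intro h x hx
    have e := congrArg (fun σ : L ≃ₐ[K] L ↦ ((σ ⟨x, hx⟩ : L) : AlgebraicClosure K)) h
    simpa only [coe_absRestrictNormalHom_apply₂₀] using e
  · intro h
    ext x
    rw [coe_absRestrictNormalHom_apply₂₀, coe_absRestrictNormalHom_apply₂₀]
    exact h x x.2

/-! ### §1. Same restriction to `K(𝔤v'^{N+1}v^{N+1})` ⟹ same action on `E_{N+c}` and `χ_π` congruent mod `π^{N+1}` -/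

section Local

variable {F : Type} [Field F] [ValuativeRel F] [TopologicalSpace F] [IsNonarchimedeanLocalField F]
  {π : 𝒪[F]} (hπ : (valuation F).IsUniformizer (π : F))

/-- ★ **`τ` fixing `K_π^{n+1}` pointwise has `χ_π(τ) ≡ 1 (mod π^{n+1})`** (`τ ∈ ker` of the level-`(n+1)` character).
[cite: CasselsFrohlichANT1967, Ch. VI §3.6 Prop. 6] -/
theorem pow_dvd_lubinTateChar_sub_one_of_mem_fixingSubgroup_ltField (n : ℕ) {τ : absoluteGaloisGroup F}
    (hτ : τ ∈ (ltField π n).fixingSubgroup) : π ^ (n + 1) ∣ (lubinTateChar hπ τ : 𝒪[F]) - 1 := by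
  haveI := isGalois_ltField hπ n
  refine pow_dvd_lubinTateChar_sub_one hπ ?_
  rw [MonoidHom.mem_ker, ltAbsChar_apply]
  have h1 : AlgEquiv.restrictNormalHom (ltField π n) (Field.absoluteGaloisGroup.toAlgEquiv F τ) = 1 := by
    ext x
    rw [AlgEquiv.restrictNormalHom_apply, AlgEquiv.one_apply]
    exact (IntermediateField.mem_fixingSubgroup_iff _ _).mp hτ x x.2
  rw [h1, map_one]

end Local

variable [IsTotallyComplex K]
  (h𝔤0 : 𝔤 ≠ ⊥) (hv : ¬ 𝔤 ≤ v.asIdeal) (hvv' : v' ≠ v) (hw : ∀ u : (𝓞 K)ˣ, (u : 𝓞 K) - 1 ∈ 𝔤 * v'.asIdeal → u = 1)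
  {π : 𝒪[v.adicCompletion K]} (hπ : (valuation (v.adicCompletion K)).IsUniformizer (π : v.adicCompletion K))
  {α : ℕ → 𝓞 K} (hα0 : ∀ i, α i ≠ 0) (hα𝔪 : ∀ i, α i - 1 ∈ 𝔤 * v'.asIdeal ^ (i + 1))
  (hαw : ∀ i, ∀ w : HeightOneSpectrum (𝓞 K), w ≠ v → α i ∉ w.asIdeal)
  {f : ℕ → ℕ} (hαπ : ∀ i, ((α i : K) : v.adicCompletion K) = (π : v.adicCompletion K) ^ f i)
  (E : ℕ → IntermediateField (v.adicCompletion K) (AlgebraicClosure (v.adicCompletion K)))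
  [∀ j, FiniteDimensional (v.adicCompletion K) (E j)] [∀ j, IsGalois (v.adicCompletion K) (E j)]
  (hmono : Monotone E) (hE : ∀ j, E j ≤ maxUnramified (v.adicCompletion K)) (c : ℕ)
  (hdegE : ∀ i, ∀ w : WeilGroup (v.adicCompletion K),
    WeilGroup.toAbsGalois (v.adicCompletion K) w ∈ (E (i + c)).fixingSubgroup → (f i : ℤ) ∣ WeilGroup.deg w)
  (hinert : ∀ i, ∀ τ : absoluteGaloisGroup (v.adicCompletion K),
    (∀ y ∈ rayClassField K (𝔤 * v'.asIdeal ^ (i + 1)),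
      τ • absClosureEmbedding K (v.adicCompletion K) y = absClosureEmbedding K (v.adicCompletion K) y) →
      τ ∈ (E (i + c)).fixingSubgroup)
  (hcount : ∀ i k : ℕ, IntermediateField.relfinrank (rayClassField K (𝔤 * v'.asIdeal ^ (i + 1) * v.asIdeal ^ (k + 1)))
      (rayClassField K (𝔤 * v'.asIdeal ^ (i + 1 + 1) * v.asIdeal ^ (k + 1))) * Module.finrank (v.adicCompletion K) (E (i + c)) ≤
      Module.finrank (v.adicCompletion K) (E (i + 1 + c)))

omit [∀ j, IsGalois (v.adicCompletion K) (E j)] in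
include h𝔤0 hv hvv' hw hα0 hα𝔪 hαw hαπ hdegE hinert in
/-- ★★ **Same finite-level restriction ⟹ same unramified action and congruent Lubin–Tate characters.**  If `σ̃, τ̃ ∈ Γ_{K_v}` restrict to
the same automorphism of `K(𝔤v'^{N+1}v^{N+1})` (along `ι : K̄ → K̄_v`), then `τ̃⁻¹σ̃` fixes the unramified base `E_{N+c}` (INERT hypothesis
at level `N`) and `π^{N+1} ∣ χ_π(σ̃) − χ_π(τ̃)` (`τ̃⁻¹σ̃` fixes `ι K(𝔤v'^{N+1}·v^{N+1})` and `E_{N+c}`, hence `K_π^{N+1}`: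
`mem_fixingSubgroup_ltField_of_forall_smul_absClosureEmbedding_eq`). [cite: deShalit1987, II.1.10 Lemma (p. 39), II.4.12 (p. 66–68)]
[cite: CasselsFrohlichANT1967, Ch. VI §3.6 Prop. 6] -/
theorem mem_fixingSubgroup_and_pow_dvd_lubinTateChar_sub_of_absRestrictNormalHom_eq (N : ℕ)
    {σ τ : absoluteGaloisGroup (v.adicCompletion K)}
    (h : absRestrictNormalHom (rayClassField K (𝔤 * v'.asIdeal ^ (N + 1) * v.asIdeal ^ (N + 1))) (absGaloisRestrict K (v.adicCompletion K) σ) =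
      absRestrictNormalHom (rayClassField K (𝔤 * v'.asIdeal ^ (N + 1) * v.asIdeal ^ (N + 1))) (absGaloisRestrict K (v.adicCompletion K) τ)) :
    τ⁻¹ * σ ∈ (E (N + c)).fixingSubgroup ∧
      π ^ (N + 1) ∣ (lubinTateChar hπ σ : 𝒪[v.adicCompletion K]) - (lubinTateChar hπ τ : 𝒪[v.adicCompletion K]) := by
  -- `τ⁻¹σ` fixes `ι K(𝔤v'^{N+1}v^{N+1})` pointwise
  have hfix : ∀ y ∈ rayClassField K (𝔤 * v'.asIdeal ^ (N + 1) * v.asIdeal ^ (N + 1)),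
      (τ⁻¹ * σ) • absClosureEmbedding K (v.adicCompletion K) y = absClosureEmbedding K (v.adicCompletion K) y := by
    intro y hy
    have hxy := (absRestrictNormalHom_eq_iff_forall_smul_eq₂₀ _ _ _).mp h y hy
    rw [mul_smul, ← absGaloisRestrict_apply_smul, hxy, absGaloisRestrict_apply_smul, inv_smul_smul]
  have hle : rayClassField K (𝔤 * v'.asIdeal ^ (N + 1)) ≤ rayClassField K (𝔤 * v'.asIdeal ^ (N + 1) * v.asIdeal ^ (N + 1)) :=
    rayClassField_le_of_le (mul_ne_zero (mul_ne_zero h𝔤0 (pow_ne_zero _ v'.ne_bot)) (pow_ne_zero _ v.ne_bot)) Ideal.mul_le_right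
  have hE' : τ⁻¹ * σ ∈ (E (N + c)).fixingSubgroup := hinert N _ fun y hy ↦ hfix y (hle hy)
  refine ⟨hE', ?_⟩
  -- hypotheses of the disjointness lemma at level `N` (modulus `𝔤v'^{N+1}`)
  have h𝔪0 : 𝔤 * v'.asIdeal ^ (N + 1) ≠ ⊥ := mul_ne_zero h𝔤0 (pow_ne_zero _ v'.ne_bot)
  have h𝔪v : ¬ 𝔤 * v'.asIdeal ^ (N + 1) ≤ v.asIdeal := by
    intro hle'
    rcases (v.isPrime.mul_le).mp hle' with h1 | h2
    · exact hv h1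
    · exact hvv' (HeightOneSpectrum.ext ((v'.isMaximal.eq_of_le v.isPrime.ne_top ((Ideal.IsPrime.pow_le_iff (hP := v.isPrime)
        (Nat.succ_ne_zero N)).mp h2))))
  have hwN : ∀ u : (𝓞 K)ˣ, (u : 𝓞 K) - 1 ∈ 𝔤 * v'.asIdeal ^ (N + 1) → u = 1 := fun u hu ↦
    hw u (Ideal.mul_mono_right (Ideal.pow_le_self (Nat.succ_ne_zero N)) hu)
  have hlt := mem_fixingSubgroup_ltField_of_forall_smul_absClosureEmbedding_eq h𝔪0 h𝔪v hwN hπ (hα0 N) (hα𝔪 N) (hαw N) (hαπ N)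
    (E (N + c)) (hdegE N) N hE' hfix
  have hd := pow_dvd_lubinTateChar_sub_one_of_mem_fixingSubgroup_ltField hπ N hlt
  have e : (lubinTateChar hπ σ : 𝒪[v.adicCompletion K]) - (lubinTateChar hπ τ : 𝒪[v.adicCompletion K]) =
      (lubinTateChar hπ τ : 𝒪[v.adicCompletion K]) * ((lubinTateChar hπ (τ⁻¹ * σ) : 𝒪[v.adicCompletion K]) - 1) := by
    rw [mul_sub, mul_one, ← Units.val_mul, ← lubinTateChar_mul, mul_inv_cancel_left]
  rw [e]
  exact hd.mul_left _

/-! ### §2. Liftable ideals prime to `𝔟` with prescribed local behaviour at level `N` -/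

include h𝔤0 hv hvv' hw hα0 hα𝔪 hαw hαπ hmono hE hdegE hinert hcount in
/-- ★★★ **De Shalit's auxiliary ideals**: for every `τ̃ ∈ Γ_{K_v}`, every level `N` and every `𝔟 ≠ 0` there is an integral ideal `𝔞`,
`IsLocArtinLiftable 𝔤 v v' 𝔞`, prime to `𝔟`, such that EVERY local lift `σ̃ ∈ Γ_{K_v}` of `(𝔞, K(𝔤v'^{N+1}v^{N+1})/K)` satisfies
`τ̃⁻¹σ̃ ∈ Gal(K̄_v/E_{N+c})` and **`χ_π(σ̃) ≡ χ_π(τ̃) (mod π^{N+1})`** (Chebotarev in the form `exists_isLocArtinLiftable_coprime_artinSymbol_eq`,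
then §1).  With `χ_π(τ̃) = γ`, `τ̃|_{E_∞} = 1` this is `𝔞₁` («`σ_{𝔞₁} ≡ σ_γ`»); with `τ̃ = σ₀` the Frobenius it is `𝔞₂`.
[cite: deShalit1987, II §2.1 (p. 49), II §4.12 (p. 66–68), II §4.14 (p. 71)] [cite: NeukirchANT1999, Ch. VII §13 Thm. (13.4)] -/
theorem exists_isLocArtinLiftable_coprime_forall_lubinTateChar_congr {𝔟 : Ideal (𝓞 K)} (h𝔟 : 𝔟 ≠ ⊥)
    (τ : absoluteGaloisGroup (v.adicCompletion K)) (N : ℕ) :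
    ∃ 𝔞 : Ideal (𝓞 K), IsLocArtinLiftable 𝔤 v v' 𝔞 ∧ IsCoprime 𝔞 𝔟 ∧
      ∀ σ : absoluteGaloisGroup (v.adicCompletion K),
        absRestrictNormalHom (rayClassField K (𝔤 * v'.asIdeal ^ (N + 1) * v.asIdeal ^ (N + 1))) (absGaloisRestrict K (v.adicCompletion K) σ) =
          artinSymbol (galFrob K (rayClassField K (𝔤 * v'.asIdeal ^ (N + 1) * v.asIdeal ^ (N + 1)))) 𝔞 →
        τ⁻¹ * σ ∈ (E (N + c)).fixingSubgroup ∧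
          π ^ (N + 1) ∣ (lubinTateChar hπ σ : 𝒪[v.adicCompletion K]) - (lubinTateChar hπ τ : 𝒪[v.adicCompletion K]) := by
  obtain ⟨𝔞, h𝔞, h𝔞𝔟, h𝔞τ⟩ := exists_isLocArtinLiftable_coprime_artinSymbol_eq h𝔤0 hv hvv' hw hπ hα0 hα𝔪 hαw hαπ E hmono hE c hdegE hinert
    hcount h𝔟 τ N
  exact ⟨𝔞, h𝔞, h𝔞𝔟, fun σ hσ ↦ mem_fixingSubgroup_and_pow_dvd_lubinTateChar_sub_of_absRestrictNormalHom_eq h𝔤0 hv hvv' hw hπ hα0 hα𝔪 hαw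
    hαπ E c hdegE hinert N (hσ.trans h𝔞τ)⟩

end Literature.NumberTheory.NumberFields

end
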